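import Summits.CriticalPhenomena.CardyFormulaZ2.Theorems.CardyWhiteToColouredSimilarityUpgradeOfRectilinearModulus
import Summits.CriticalPhenomena.CardyFormulaZ2.Theorems.CardyWhiteToColouredSimilarityUpgradeStubModulusGlue
import Summits.CriticalPhenomena.CardyFormulaZ2.Theorems.CardyWhiteToColouredSimilarityUpgradeRectangleContinuity

/-!
# `SimilarityUpgrade` reduced to its irreducible heart H3 (crux stmt-CriticalPhenomena-4597)

Route `CardyWhiteToColoured`, sub-problem `CardyFormulaZ2`, line `registered` of crux
`Summit.CriticalPhenomena.CardyFormulaZ2.Theses.CardyWhiteToColoured.SimilarityUpgrade`.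

Cycle c1 reduced the crux to H = "full, similarity-invariant bond-ℤ² crossing limits factor through
the conformal modulus on rectilinear conformal rectangles through a CONTINUOUS `f`"
(`similarityUpgrade_of_rectilinearModulusUpgrade`, p148200). Cycle c2 proved the regularity half of
H inside the tree (`Stubs.rectangleContinuity`: no jump of `w ↦ Φ(box (0,w)×(0,1))`, from the
extremal-point bound `real_localTopEvent_le`, one-arm decay and c1's box identification) and the glue
`Stubs.stub_modulusGlue` (`f := Φ ∘ box ∘ η⁻¹`, `rectangle_crossRatio_eq_of_aspectRatio_holds`).
Hence (this file, sorry-free compositions):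

* `rectilinearModulusUpgrade_of_rectilinearHeart` : H3 → H;
* `similarityUpgrade_of_rectilinearHeart` : H3 → `SimilarityUpgrade`,

where **H3 (the heart, registered stub `stub_rectilinearHeart`, open-problem class)** says: if the
bond-ℤ² crossing probabilities of every conformal rectangle converge to a similarity-invariant `Φ`,
then a RECTILINEAR conformal rectangle `R` and a corner-marked box `R' = ((0,w)×(0,1); i, 0, w, w+i)`
of equal cross-ratio have `Φ R = Φ R'` — "Euclidean + scale ⇒ conformal" for crossing limits,
localised to rectilinear polygons versus rectangles, with no continuity clause left. This is exactly
what remains of the crux modulo tree theorems.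

References: S. Smirnov, C. R. Acad. Sci. 333 (2001); O. Schramm, S. Smirnov, Ann. Probab. 39 (2011);
B. Bollobás, O. Riordan, *Percolation* (2006), Ch. 7.
-/

noncomputable section

namespace Summit.CriticalPhenomena.CardyFormulaZ2.Theorems.SimilarityUpgradeReduction

open Filter Topology Set
open Literature.Probability.RandomPlanarGeometry
open Literature.Probability.Percolation (bondDomainCrossingProb)
open Summit.CriticalPhenomena.CardyFormulaZ2.Cruxes.SimilarityUpgrade

/-- **H3 ⇒ H**: the heart (rectilinear quad = corner-marked box of equal modulus, under full
similarity-invariant limits) implies the c1 heart H (factorisation through the modulus on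
rectilinear rectangles with a continuous modulus function), by the landed glue `stub_modulusGlue`
fed with the landed rectangle continuity `Stubs.rectangleContinuity`. -/
theorem rectilinearModulusUpgrade_of_rectilinearHeart
    (hH3 : ∀ Φ : ConformalRectangle → ℝ,
      (∀ R : ConformalRectangle, Tendsto (bondDomainCrossingProb R) (𝓝[>] (0 : ℝ)) (𝓝 (Φ R))) →
      (∀ (R R' : ConformalRectangle) (a w : ℂ), a ≠ 0 →
        R'.carrier = (fun z : ℂ => a * z + w) '' R.carrier →
        R'.arc 0 = (fun z : ℂ => a * z + w) '' R.arc 0 →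
        R'.arc 2 = (fun z : ℂ => a * z + w) '' R.arc 2 → Φ R' = Φ R) →
      ∀ (R R' : ConformalRectangle),
        (∃ S : Finset (ℂ × ℂ), (∀ p ∈ S, p.1.re = p.2.re ∨ p.1.im = p.2.im) ∧
          frontier R.carrier ⊆ ⋃ p ∈ S, segment ℝ p.1 p.2) →
        (∃ w : ℝ, 0 < w ∧ R'.carrier = (Ioo (0 : ℝ) w ×ℂ Ioo (0 : ℝ) 1) ∧
          R'.arc 0 = {z : ℂ | z.re = 0 ∧ z.im ∈ Icc (0 : ℝ) 1} ∧
          R'.arc 2 = {z : ℂ | z.re = w ∧ z.im ∈ Icc (0 : ℝ) 1} ∧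
          R'.pt 0 = Complex.I ∧ R'.pt 1 = 0 ∧ R'.pt 2 = (w : ℂ) ∧ R'.pt 3 = (w : ℂ) + Complex.I) →
        ∀ (φ : ConformalEquiv UpperHalfPlane.upperHalfPlaneSet R.carrier) (x : Fin 4 → ℝ)
          (φ' : ConformalEquiv UpperHalfPlane.upperHalfPlaneSet R'.carrier) (x' : Fin 4 → ℝ),
          R.IsUniformizing φ x → R'.IsUniformizing φ' x' → crossRatio x = crossRatio x' →
          Φ R = Φ R') :
    ∀ Φ : ConformalRectangle → ℝ,
      (∀ R : ConformalRectangle, Tendsto (bondDomainCrossingProb R) (𝓝[>] (0 : ℝ)) (𝓝 (Φ R))) →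
      (∀ (R R' : ConformalRectangle) (a w : ℂ), a ≠ 0 →
        R'.carrier = (fun z : ℂ => a * z + w) '' R.carrier →
        R'.arc 0 = (fun z : ℂ => a * z + w) '' R.arc 0 →
        R'.arc 2 = (fun z : ℂ => a * z + w) '' R.arc 2 → Φ R' = Φ R) →
      ∃ f : ℝ → ℝ, ContinuousOn f (Ioo 0 1) ∧
        ∀ R : ConformalRectangle,
          (∃ S : Finset (ℂ × ℂ), (∀ p ∈ S, p.1.re = p.2.re ∨ p.1.im = p.2.im) ∧
            frontier R.carrier ⊆ ⋃ p ∈ S, segment ℝ p.1 p.2) →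
          ∀ (φ : ConformalEquiv UpperHalfPlane.upperHalfPlaneSet R.carrier) (x : Fin 4 → ℝ),
            R.IsUniformizing φ x → Φ R = f (crossRatio x) :=
  Stubs.stub_modulusGlue Stubs.rectangleContinuity hH3

/-- **`SimilarityUpgrade` from its irreducible heart H3** (sorry-free composition of the whole line:
c1's composition `similarityUpgrade_of_rectilinearModulusUpgrade` with
`rectilinearModulusUpgrade_of_rectilinearHeart`): if, under full similarity-invariant bond-ℤ²
crossing limits `Φ`, every rectilinear conformal rectangle has the limit of the corner-marked box of
equal modulus, then the route decl `SimilarityUpgrade` holds. -/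
theorem similarityUpgrade_of_rectilinearHeart :
    (∀ Φ : ConformalRectangle → ℝ,
      (∀ R : ConformalRectangle, Tendsto (bondDomainCrossingProb R) (𝓝[>] (0 : ℝ)) (𝓝 (Φ R))) →
      (∀ (R R' : ConformalRectangle) (a w : ℂ), a ≠ 0 →
        R'.carrier = (fun z : ℂ => a * z + w) '' R.carrier →
        R'.arc 0 = (fun z : ℂ => a * z + w) '' R.arc 0 →
        R'.arc 2 = (fun z : ℂ => a * z + w) '' R.arc 2 → Φ R' = Φ R) →
      ∀ (R R' : ConformalRectangle),
        (∃ S : Finset (ℂ × ℂ), (∀ p ∈ S, p.1.re = p.2.re ∨ p.1.im = p.2.im) ∧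
          frontier R.carrier ⊆ ⋃ p ∈ S, segment ℝ p.1 p.2) →
        (∃ w : ℝ, 0 < w ∧ R'.carrier = (Ioo (0 : ℝ) w ×ℂ Ioo (0 : ℝ) 1) ∧
          R'.arc 0 = {z : ℂ | z.re = 0 ∧ z.im ∈ Icc (0 : ℝ) 1} ∧
          R'.arc 2 = {z : ℂ | z.re = w ∧ z.im ∈ Icc (0 : ℝ) 1} ∧
          R'.pt 0 = Complex.I ∧ R'.pt 1 = 0 ∧ R'.pt 2 = (w : ℂ) ∧ R'.pt 3 = (w : ℂ) + Complex.I) →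
        ∀ (φ : ConformalEquiv UpperHalfPlane.upperHalfPlaneSet R.carrier) (x : Fin 4 → ℝ)
          (φ' : ConformalEquiv UpperHalfPlane.upperHalfPlaneSet R'.carrier) (x' : Fin 4 → ℝ),
          R.IsUniformizing φ x → R'.IsUniformizing φ' x' → crossRatio x = crossRatio x' →
          Φ R = Φ R') →
    Summit.CriticalPhenomena.CardyFormulaZ2.Theses.CardyWhiteToColoured.SimilarityUpgrade :=
  fun hH3 =>
    similarityUpgrade_of_rectilinearModulusUpgrade (rectilinearModulusUpgrade_of_rectilinearHeart hH3)

end Summit.CriticalPhenomena.CardyFormulaZ2.Theorems.SimilarityUpgradeReduction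

end
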